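import Summits.HodgeConjecture.CorCM.AbelianCMFieldsStablyNondegenerate
import Summits.HodgeConjecture.CorCM.CMFieldSmallDegreeAllTypes
import Summits.HodgeConjecture.CorCM.GaloisImaginaryQuadraticClassification
import HarnessLib

/-!
# Galois CM fields containing an imaginary quadratic field: ALL abelian varieties with complex multiplication by
# `K` are stably nondegenerate iff `Gal(K/k) ∈ {1, C₂, C₂², C₄, C₂³, C_p, S₃}`

COR-CM (cell `pub-hodgecm2`), binder seat b04 (gen 21), count-neutral claim IMAGINARY-QUADRATIC-ALLTYPES — the all-types
upgrade of gen 19's CAPSTONE (`GaloisImaginaryQuadraticClassification.forall_isSimple_isNondegenerate_iff_of_quadratic`: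
`K/ℚ` Galois CM with an imaginary quadratic subfield `k`, `m = [K:k]`: every SIMPLE abelian variety with CM by `K` is
nondegenerate ⟺ `m` prime ∨ `m = 1` ∨ `m = 4` ∨ (`m = 6`, `Gal(K/k)` non-abelian) ∨ (`m = 8`, `Gal(K/k)` of exponent `2`)).
KERNEL ONLY: theorems; no definition, no named fact, no `sorry`.  `HC_CM` is neither used nor claimed.

Every good case is ALL-TYPES by the gen-21 files: `m` prime — prime dimension (lit-hodgefound
`EndFieldFullDegree.isStablyNondegenerate_of_prime`, Tankeev–Ribet–Yanai with no simplicity); `m = 1` — elliptic curves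
(`…_of_dim_le_three`); `m = 4` — Galois octic, `m = 6` non-abelian — Galois dodecic (`SmallDegreeAllTypes.isStably
Nondegenerate_of_finrank_le_twelve`, part V); `m = 8` of exponent `2` — `Gal(K/ℚ) = (ℤ/2)⁴` abelian with (γ)
(`AbelianAllTypes.isStablyNondegenerate_of_good_two_power`, part VII).  So the simple classification IS the all-X
classification: **`forall_isStablyNondegenerate_iff_of_quadratic`**.

## References

* [Yanai1985] H. Yanai, *On the rank of CM-type*, Nagoya Math. J. 97 (1985), §4 Theorem.
* [Dodson1984] B. Dodson, *The structure of Galois groups of CM-fields*, Trans. AMS 283 (1984), §3.1.1, §3.2.1, §4.1.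
* [Shimura1998] G. Shimura, *Abelian Varieties with Complex Multiplication and Modular Functions* (1998), §5.1 Prop. 3,
  §6.2 Thm. 3, §8.2 Prop. 26.
* [Gordon1999HodgeAVSurvey] B. B. Gordon, *A survey of the Hodge conjecture for abelian varieties*, Thm. 6.3–6.4, §9.4.3.
-/

noncomputable section

open CategoryTheory CategoryTheory.Limits NumberField

namespace Summit.HodgeConjecture.CorCM.ImaginaryQuadraticAllTypes

open Literature.NumberTheory.ComplexMultiplication
open Literature.AlgebraicGeometry Literature.AlgebraicGeometry.Motives Literature.AlgebraicGeometry.HodgeTheory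
open Literature.AlgebraicGeometry.Motives.AbelianVariety
open Literature.AlgebraicGeometry.ComplexMultiplication
open Literature.AlgebraicGeometry.Pohlmann1968
open Summit.HodgeConjecture.HodgeConjecture.Ring2.ClassTargets
open Summit.HodgeConjecture.CorCM.TwiceOdd (forall_mul_self_eq_one_of_fixingSubgroup mem_or_complexConj_mul_mem_of_quadratic
  forall_isPrimitive_isNondegenerate_iff_of_quadratic)

variable {K : Type} [Field K] [NumberField K] [IsCMField K] [IsGalois ℚ K]

/-! ## §1 The good side: every abelian variety with a `K`-action is stably nondegenerate -/

/-- **THEOREM (ALL TYPES).  `K/ℚ` Galois CM, `k ⊆ K` imaginary quadratic, `m = [K:k]` with `m` prime ∨ `m = 1` ∨ `m = 4`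
∨ (`m = 6`, `Gal(K/k)` non-abelian) ∨ (`m = 8`, `Gal(K/k)` of exponent `2`): EVERY complex abelian variety `X` with
`φ : K →+* End⁰(X)`, `[K:ℚ] = 2 dim X` — simple or not — is STABLY NONDEGENERATE.** UNCONDITIONAL.
[cite: Yanai1985, §4 Theorem] [cite: Gordon1999HodgeAVSurvey, Thm. 6.3–6.4 and §9.4.3] [cite: Shimura1998, §5.1 Prop. 3, §8.2 Prop. 26] -/
theorem isStablyNondegenerate_of_quadratic_of_good (k : IntermediateField ℚ K) (hk : Module.finrank ℚ k = 2)
    (τ₀ : k →+* ℂ) (hτ₀ : ComplexEmbedding.conjugate τ₀ ≠ τ₀)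
    (hgood : (Module.finrank k K).Prime ∨ Module.finrank k K = 1 ∨ Module.finrank k K = 4 ∨
      (Module.finrank k K = 6 ∧ ∃ a ∈ k.fixingSubgroup, ∃ b ∈ k.fixingSubgroup, a * b ≠ b * a) ∨
      (Module.finrank k K = 8 ∧ ∀ h ∈ k.fixingSubgroup, h * h = 1))
    {X : AbelianVariety ℂ} (φ : K →+* X.endAlgebra) (hX : Module.finrank ℚ K = 2 * X.dim) :
    IsStablyNondegenerate X := by
  have hKk : Module.finrank ℚ K = 2 * Module.finrank k K := by
    rw [← Module.finrank_mul_finrank ℚ k K, hk]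
  have hdim : X.dim = Module.finrank k K := by omega
  rcases hgood with hp | h1 | h4 | ⟨h6, a, -, b, -, hab⟩ | ⟨h8, hexp⟩
  · exact EndFieldFullDegree.isStablyNondegenerate_of_prime φ hX (hdim ▸ hp)
  · exact EndFieldFullDegree.isStablyNondegenerate_of_dim_le_three φ hX (by omega)
  · exact SmallDegreeAllTypes.isStablyNondegenerate_of_finrank_le_twelve (by omega) (fun _ => inferInstance)
      (fun h => by omega) φ hX
  · exact SmallDegreeAllTypes.isStablyNondegenerate_of_finrank_le_twelve (by omega) (fun h => by omega)
      (fun _ => ⟨inferInstance, Or.inl ⟨a, b, hab⟩⟩) φ hX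
  · obtain ⟨-, hH⟩ := mem_or_complexConj_mul_mem_of_quadratic k hk τ₀ hτ₀
    obtain ⟨hsq, hcomm⟩ := forall_mul_self_eq_one_of_fixingSubgroup hH hexp
    have hK16 : Module.finrank ℚ K = 2 ^ (3 + 1) := by rw [hKk, h8]; norm_num
    exact AbelianAllTypes.isStablyNondegenerate_of_good_two_power hcomm hK16
      (Or.inr (Or.inr ⟨by rw [hKk, h8], fun g => Or.inl (hsq g)⟩)) φ hX

/-- **The Hodge conjecture for everything isogenous to a power of such an `X`.** UNCONDITIONAL.
[cite: Gordon1999HodgeAVSurvey, Thm. 6.3–6.4] [cite: vanGeemen1994HodgeAV, Lemma 3.7] -/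
theorem hodgeConjectureFor_of_isIsogenous_powSucc_of_quadratic_of_good (k : IntermediateField ℚ K)
    (hk : Module.finrank ℚ k = 2) (τ₀ : k →+* ℂ) (hτ₀ : ComplexEmbedding.conjugate τ₀ ≠ τ₀)
    (hgood : (Module.finrank k K).Prime ∨ Module.finrank k K = 1 ∨ Module.finrank k K = 4 ∨
      (Module.finrank k K = 6 ∧ ∃ a ∈ k.fixingSubgroup, ∃ b ∈ k.fixingSubgroup, a * b ≠ b * a) ∨
      (Module.finrank k K = 8 ∧ ∀ h ∈ k.fixingSubgroup, h * h = 1))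
    {X : AbelianVariety ℂ} (φ : K →+* X.endAlgebra) (hX : Module.finrank ℚ K = 2 * X.dim) {B : AbelianVariety ℂ}
    {N : ℕ} (h : IsIsogenous B (X.powSucc N)) : HodgeConjectureFor B.dim B.X :=
  (isStablyNondegenerate_of_quadratic_of_good k hk τ₀ hτ₀ hgood φ hX).hodgeConjectureFor_of_isIsogenous_powSucc h

variable {Φ : CMType K} {A : AbelianVariety ℂ} {ι : 𝓞 K →+* End A} {θ : K →+* Module.End ℂ (complexBetti A.X 1)}

/-- **Realisation form: the Hodge conjecture for every power of EVERY abelian variety with CM by `K`** in the good cases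
(gen 19's `hodgeConjectureFor_pow_of_isSimple_of_quadratic_of_good` without `A.IsSimple`).
[cite: Gordon1999HodgeAVSurvey, Thm. 6.3–6.4] [cite: Yanai1985, Remark (p. 172)] -/
theorem hodgeConjectureFor_pow_of_quadratic_of_good (k : IntermediateField ℚ K) (hk : Module.finrank ℚ k = 2)
    (τ₀ : k →+* ℂ) (hτ₀ : ComplexEmbedding.conjugate τ₀ ≠ τ₀)
    (hgood : (Module.finrank k K).Prime ∨ Module.finrank k K = 1 ∨ Module.finrank k K = 4 ∨
      (Module.finrank k K = 6 ∧ ∃ a ∈ k.fixingSubgroup, ∃ b ∈ k.fixingSubgroup, a * b ≠ b * a) ∨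
      (Module.finrank k K = 8 ∧ ∀ h ∈ k.fixingSubgroup, h * h = 1))
    (hA : IsCMTypeRealisation Φ A ι θ) (N : ℕ) :
    HodgeConjectureFor (⨁ fun _ : Fin N => A).dim (⨁ fun _ : Fin N => A).X := by
  obtain ⟨i, -⟩ := exists_ringHom_endAlgebra ι
  exact hodgeConjectureFor_of_isDivisorGenerated _
    ((isStablyNondegenerate_iff_forall_isDivisorGenerated_biproduct A).1
      (isStablyNondegenerate_of_quadratic_of_good k hk τ₀ hτ₀ hgood i
        (finrank_eq_two_mul_dim_of_isCMTypeRealisation hA)) N)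

/-! ## §2 The classification for all abelian varieties -/

/-- **THE CLASSIFICATION (all abelian varieties).**  `K/ℚ` Galois CM with an imaginary quadratic subfield `k`, `m = [K:k]`:
EVERY complex abelian variety `X` with `K ↪ End⁰(X)`, `[K:ℚ] = 2 dim X`, is stably nondegenerate ⟺ `m` prime ∨ `m = 1` ∨
`m = 4` ∨ (`m = 6`, `Gal(K/k)` non-abelian) ∨ (`m = 8`, `Gal(K/k)` of exponent `2`) — i.e. iff
`Gal(K/k) ∈ {1, C₂, C₂², C₄, C₂³, C_p, S₃}`: the same list as for SIMPLE varieties (gen 19).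
[cite: Yanai1985, §4 Theorem] [cite: Dodson1984, §3.1.1, §3.2.1 and §4.1] [cite: Gordon1999HodgeAVSurvey, Thm. 6.4 and §9.4.3]
[cite: Shimura1998, §6.2 Thm. 3 and §8.2 Prop. 26] -/
theorem forall_isStablyNondegenerate_iff_of_quadratic (k : IntermediateField ℚ K) (hk : Module.finrank ℚ k = 2)
    (τ₀ : k →+* ℂ) (hτ₀ : ComplexEmbedding.conjugate τ₀ ≠ τ₀) :
    (∀ (X : AbelianVariety ℂ) (_ : K →+* X.endAlgebra), Module.finrank ℚ K = 2 * X.dim → IsStablyNondegenerate X) ↔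
      ((Module.finrank k K).Prime ∨ Module.finrank k K = 1 ∨ Module.finrank k K = 4 ∨
        (Module.finrank k K = 6 ∧ ∃ a ∈ k.fixingSubgroup, ∃ b ∈ k.fixingSubgroup, a * b ≠ b * a) ∨
        (Module.finrank k K = 8 ∧ ∀ h ∈ k.fixingSubgroup, h * h = 1)) := by
  refine ⟨fun h => ?_, fun hgood X φ hX => isStablyNondegenerate_of_quadratic_of_good k hk τ₀ hτ₀ hgood φ hX⟩
  obtain ⟨φ₀⟩ := (inferInstance : Nonempty (K →+* ℂ))
  rw [← forall_isPrimitive_isNondegenerate_iff_of_quadratic k hk τ₀ hτ₀ φ₀]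
  intro Ψ hprim
  obtain ⟨B, ιB, θB, hB⟩ := exists_isCMTypeRealisation_of_realised cmAbelianVarietyRealised_holds K Ψ
  obtain ⟨i, -⟩ := exists_ringHom_endAlgebra ιB
  exact (isStablyNondegenerate_iff_isNondegenerate φ₀ hprim hB).1
    (h B i (finrank_eq_two_mul_dim_of_isCMTypeRealisation hB))

/-- **The same in the realisation vocabulary**: every abelian variety `(A, ι)` of ANY CM type `(K; Φ)` is stably
nondegenerate ⟺ `Gal(K/k) ∈ {1, C₂, C₂², C₄, C₂³, C_p, S₃}`. [cite: Gordon1999HodgeAVSurvey, Thm. 6.4]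
[cite: Shimura1998, §8.2 Prop. 26] -/
theorem forall_realisation_isStablyNondegenerate_iff_of_quadratic (k : IntermediateField ℚ K)
    (hk : Module.finrank ℚ k = 2) (τ₀ : k →+* ℂ) (hτ₀ : ComplexEmbedding.conjugate τ₀ ≠ τ₀) :
    (∀ (Φ : CMType K) (A : AbelianVariety ℂ) (ι : 𝓞 K →+* End A) (θ : K →+* Module.End ℂ (complexBetti A.X 1)),
        IsCMTypeRealisation Φ A ι θ → IsStablyNondegenerate A) ↔
      ((Module.finrank k K).Prime ∨ Module.finrank k K = 1 ∨ Module.finrank k K = 4 ∨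
        (Module.finrank k K = 6 ∧ ∃ a ∈ k.fixingSubgroup, ∃ b ∈ k.fixingSubgroup, a * b ≠ b * a) ∨
        (Module.finrank k K = 8 ∧ ∀ h ∈ k.fixingSubgroup, h * h = 1)) := by
  rw [← forall_isStablyNondegenerate_iff_of_quadratic k hk τ₀ hτ₀]
  constructor
  · intro h X i hX
    obtain ⟨X', φ', ι', hφι, f, hf⟩ := exists_principal_pair i
    have hdim' : Module.finrank ℚ K = 2 * X'.dim := by rw [← dim_eq_of_isIsogeny hf, hX]
    exact (h _ X' ι' _ (isCMTypeRealisation_cmTypeOfPair φ' hdim' ι' hφι)).of_isIsogenous ⟨f, hf⟩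
  · intro h Φ A ι θ hA
    obtain ⟨i, -⟩ := exists_ringHom_endAlgebra ι
    exact h A i (finrank_eq_two_mul_dim_of_isCMTypeRealisation hA)

/-! ## §3 Class-target display -/

/-- **HC on the class «isogenous to a power of an abelian variety `X` with an action of a Galois CM field `K ⊇ k`
(imaginary quadratic) with `Gal(K/k) ∈ {1, C₂, C₂², C₄, C₂³, C_p, S₃}`, `[K:ℚ] = 2 dim X`»** — UNCONDITIONAL, no
simplicity (gen 19's `HCOnClass` display strengthened). [cite: Gordon1999HodgeAVSurvey, Thm. 6.3–6.4 and §9.4.3] -/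
theorem hcOnClass_isIsogenous_powSucc_galoisCM_quadratic_good :
    HCOnClass fun B ↦ ∃ (X : AbelianVariety ℂ) (N : ℕ) (K : Type) (_ : Field K) (_ : NumberField K)
      (_ : IsCMField K) (_ : IsGalois ℚ K) (k : IntermediateField ℚ K) (τ₀ : k →+* ℂ),
      Module.finrank ℚ k = 2 ∧ ComplexEmbedding.conjugate τ₀ ≠ τ₀ ∧
      ((Module.finrank k K).Prime ∨ Module.finrank k K = 1 ∨ Module.finrank k K = 4 ∨
        (Module.finrank k K = 6 ∧ ∃ a ∈ k.fixingSubgroup, ∃ b ∈ k.fixingSubgroup, a * b ≠ b * a) ∨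
        (Module.finrank k K = 8 ∧ ∀ h ∈ k.fixingSubgroup, h * h = 1)) ∧
      Module.finrank ℚ K = 2 * X.dim ∧ Nonempty (K →+* X.endAlgebra) ∧ IsIsogenous B (X.powSucc N) := by
  rintro B ⟨X, N, K, _, _, _, _, k, τ₀, hk, hτ₀, hgood, hX, ⟨φ⟩, h⟩
  exact hodgeConjectureFor_of_isIsogenous_powSucc_of_quadratic_of_good k hk τ₀ hτ₀ hgood φ hX h

end Summit.HodgeConjecture.CorCM.ImaginaryQuadraticAllTypes

end
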